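import Summits.NavierStokesRegularity.NavierStokesRegularity.Theses.PlaneEnergyCeiling
import HarnessLib

/-!
# Strategist sketch (gen 1) — crux `PlaneEnergyCeiling.PlanarEnergyAPriori` (stmt-NavierStokesRegularity-16855)

Typed statements backing `STRATEGY-CENSUS.md` (gen 1).  Nothing here is a registered skeleton;
no `sorry`.  New this generation:

* `FluxVariationBound` — the judge's "lemma bounding the slab Bernoulli flux by planar energy and
  dissipation": `osc_c F(R,·) ≤ C · √(sup_c E(R,c)) · ‖∇u‖₂²` (kinematic + NS pressure; provable now
  modulo the Riesz-transform `L^{4/3}` bound, RRS2016 Lemma 5.1 (5.8)).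
* `DynamicPlanarCeiling` — what the 1-D mild slab law yields with that lemma (Volterra closure):
  `E(t;R,c) ≤ 2·P(0) + (C/ν) · W(t)²`, `W(t) = sup_{t'≤t} ∫₀^{t'} ‖∇u(s)‖₂² (t'−s)^{-1/2} ds`.
* `HalfPotentialEnstrophyBound` — the hypothesis under which the dynamic ceiling closes, and the
  kernel-checked glue `planarEnergyAPriori_of_dynamicCeiling`; `HalfPotentialDivergesAtBlowup` —
  why that hypothesis is NoBlowup again (Leray's enstrophy rate, RRS2016 Lemma 6.11).
* `TypeIEnstrophyLogSqCeiling` — the conditional corollary: Leray-rate enstrophy ⇒ `P ≲ log²`.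
-/

set_option linter.dupNamespace false

noncomputable section

namespace Summit.NavierStokesRegularity.NavierStokesRegularity.Cruxes.PlanarEnergyAPriori.StrategistG1

open scoped ENNReal
open MeasureTheory Set

local notation "E3" => EuclideanSpace ℝ (Fin 3)
local notation "E2" => EuclideanSpace ℝ (Fin 2)

/-- The route's plane parametrisation: the point of `R({x₂ = c})` above `y ∈ ℝ²`. -/
def planePt (R : E3 ≃ₗᵢ[ℝ] E3) (y : E2) (c : ℝ) : E3 := R (WithLp.toLp 2 ![y 0, y 1, c])

/-- Planar kinetic energy of a slice `w` through `R({x₂ = c})` (the crux's integrand). -/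
def planarEnergy (w : E3 → E3) (R : E3 ≃ₗᵢ[ℝ] E3) (c : ℝ) : ℝ≥0∞ :=
  ∫⁻ y : E2, ‖w (planePt R y c)‖ₑ ^ 2

/-- Directional planar ceiling `P_R(w) = sup_c E(w;R,c)` and the full ceiling `P(w) = sup_{R,c}`. -/
def planarCeilingDir (w : E3 → E3) (R : E3 ≃ₗᵢ[ℝ] E3) : ℝ≥0∞ := ⨆ c : ℝ, planarEnergy w R c

def planarCeiling (w : E3 → E3) : ℝ≥0∞ := ⨆ (R : E3 ≃ₗᵢ[ℝ] E3) (c : ℝ), planarEnergy w R c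

/-- Bernoulli flux through `R({x₂ = c})`: `F = ∫_Π (|u|²/2 + p) ⟪u, R e₂⟫ dA` (as in `birth`). -/
def bernoulliFlux (u : E3 → E3) (p : E3 → ℝ) (R : E3 ≃ₗᵢ[ℝ] E3) (c : ℝ) : ℝ :=
  ∫ y : E2, (‖u (planePt R y c)‖ ^ 2 / 2 + p (planePt R y c)) *
    inner ℝ (u (planePt R y c)) (R (EuclideanSpace.single 2 1))

/-- Enstrophy-type dissipation `Z(w) = ∫ ‖∇w‖ₑ²` (operator norm of the Fréchet derivative; it is
comparable to the Frobenius form used by the route, `‖A‖ₒₚ² ≤ Σⱼ‖A eⱼ‖² ≤ 3‖A‖ₒₚ²`). -/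
def dissipation (w : E3 → E3) : ℝ≥0∞ := ∫⁻ x : E3, ‖fderiv ℝ w x‖ₑ ^ 2

/-- The NS pressure Poisson equation `−Δp = Σᵢⱼ ∂ᵢuⱼ ∂ⱼuᵢ` (= `∂ᵢ∂ⱼ(uᵢuⱼ)` for div-free `u`). -/
def IsNSPressureOf (u : E3 → E3) (p : E3 → ℝ) : Prop :=
  ∀ x, Laplacian.laplacian p x =
    -∑ i : Fin 3, ∑ j : Fin 3,
      (fderiv ℝ u x (EuclideanSpace.single i 1)) j * (fderiv ℝ u x (EuclideanSpace.single j 1)) i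

/-! ## F1 — the flux variation lemma (judge's mover 1; provable now modulo Riesz `L^{4/3}`) -/

/-- **FLUX VARIATION BOUND.** There is a universal `C` such that for every smooth rapidly decaying
divergence-free `u` with its decaying NS pressure `p`, every direction `R` and offsets `a, b`:
`|F(R,a) − F(R,b)| ≤ C · √(sup_c E(u;R,c)) · ∫‖∇u‖²`.  Proof on paper: `|F(a)−F(b)| ≤ ∫|∂_cF| dc
≤ (3/2)∫|u|²|∇u| + ∫|u||∇p| + ∫|p||∇u|`; slice-wise 2-D Ladyzhenskaya `‖u‖²_{L⁴(Π)} ≤ √2‖u‖_{L²(Π)}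
‖∇_∥u‖_{L²(Π)}` gives `∫|u|²|∇u| ≤ √2 √P_R · Z` and `‖u‖⁴_{L⁴(ℝ³)} ≤ 2 P_R Z`; Plancherel gives
`‖p‖₂ ≤ 3Σ‖uᵢ‖²_{L⁴}`; Riesz `L^{4/3}` (RRS2016 Lemma 5.1 (5.8)) gives `‖∇p‖_{4/3} ≤ C‖u‖_{L⁴}‖∇u‖₂`.
Dimension check: both sides scale like `U³L²`; the exponent `1/2` on `P_R` is kinematically
optimal (a single blob of local Reynolds number `Re` has `osc F / (P^a ν^{1−2a} Z) ∼ Re^{1−2a}`). -/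
def FluxVariationBound : Prop :=
  ∃ C : ℝ, 0 < C ∧ ∀ (u : E3 → E3) (p : E3 → ℝ), ContDiff ℝ (⊤ : ℕ∞) u → ContDiff ℝ (⊤ : ℕ∞) p →
    Literature.Analysis.FluidPDE.HasRapidSpatialDecay u →
    Literature.Analysis.FluidPDE.HasRapidSpatialDecay p →
    Literature.Analysis.FluidPDE.VectorCalculus.IsDivFree u → IsNSPressureOf u p →
    ∀ (R : E3 ≃ₗᵢ[ℝ] E3) (a b : ℝ),
      ‖bernoulliFlux u p R a - bernoulliFlux u p R b‖ₑ ≤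
        ENNReal.ofReal C * (planarCeilingDir u R) ^ (1 / 2 : ℝ) * dissipation u

/-! ## F2 — the dynamic planar ceiling (Volterra closure of the mild slab law) -/

/-- The parabolic half-potential of the dissipation up to time `t`:
`I(u;t) = ∫₀ᵗ (t−s)^{-1/2} Z(u(s)) ds` (in `ℝ≥0∞`). -/
def halfPotential (u : ℝ → E3 → E3) (t : ℝ) : ℝ≥0∞ :=
  ∫⁻ s in Ioo 0 t, ENNReal.ofReal ((Real.sqrt (t - s))⁻¹) * dissipation (u s)

/-- **DYNAMIC PLANAR CEILING** (provable from `birth`'s stubs 2–3 + `FluxVariationBound`; t < T):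
along every classical Leray–Hopf solution from a rapidly decaying datum on `[0,T)`,
`E(u(t);R,c) ≤ 2·P(u(0)) + (C/ν) · (sup_{t' ≤ t} I(u;t'))²` for all `t < T`, `R`, `c`.
(Mild slab law: `P_R(t) ≤ P_R(0) + 2∫₀ᵗ(πν(t−s))^{-1/2} osc F`; insert F1 and absorb `√Q`:
`Q ≤ P(0) + 2C(πν)^{-1/2}√Q·W ⇒ Q ≤ 2P(0) + 4C²W²/(πν)`, `Q(t) = sup_{[0,t]} P < ∞` by the landed
closed-slab theorem `planarEnergyAPriori_closedSlab`.)  It improves Agmon's `(T*−t)^{-1/4}` to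
`log²` under Leray-rate enstrophy, and is finite exactly as long as the half-potential is. -/
def DynamicPlanarCeiling : Prop :=
  ∃ C : ℝ, 0 < C ∧ ∀ (ν T : ℝ), 0 < ν → 0 < T → ∀ (u : ℝ → E3 → E3) (p : ℝ → E3 → ℝ),
    Literature.Analysis.FluidPDE.IsClassicalNSSolutionOn (Set.Ico 0 T) ν 0 u p →
    Literature.Analysis.FluidPDE.IsLerayHopfOn T ν 0 (u 0) u →
    Literature.Analysis.FluidPDE.HasRapidSpatialDecay (u 0) →
    ∀ t ∈ Set.Ico 0 T, ∀ (R : E3 ≃ₗᵢ[ℝ] E3) (c : ℝ),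
      planarEnergy (u t) R c ≤
        2 * planarCeiling (u 0) + ENNReal.ofReal (C / ν) * (⨆ t' ∈ Set.Icc 0 t, halfPotential u t') ^ 2

/-- **The closing hypothesis: bounded enstrophy half-potential up to `T`.** -/
def HalfPotentialEnstrophyBound (T : ℝ) (u : ℝ → E3 → E3) : Prop :=
  ∃ W : ℝ, 0 ≤ W ∧ ∀ t ∈ Set.Ico 0 T, halfPotential u t ≤ ENNReal.ofReal W

/-- Initial planar ceiling from rapid decay (`birth` stub 1, LANDED as
`Theorems.PlanarEnergyAPriori.stub_initialPlanarCeiling`), restated over `planarCeiling`. -/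
def InitialPlanarCeiling : Prop :=
  ∀ (u₀ : E3 → E3), Literature.Analysis.FluidPDE.HasRapidSpatialDecay u₀ →
    ∃ M₀ : ℝ, 0 ≤ M₀ ∧ planarCeiling u₀ ≤ ENNReal.ofReal M₀

/-- **Kernel-checked glue (D6 of the census):** the dynamic ceiling + a bounded half-potential along
every frame solution + the initial ceiling give the crux BY NAME.  The open piece is the
half-potential bound, and `HalfPotentialDivergesAtBlowup` shows it is NoBlowup in other clothes. -/
theorem planarEnergyAPriori_of_dynamicCeiling (hD : DynamicPlanarCeiling) (hI : InitialPlanarCeiling)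
    (hW : ∀ (ν T : ℝ), 0 < ν → 0 < T → ∀ (u : ℝ → E3 → E3) (p : ℝ → E3 → ℝ),
      Literature.Analysis.FluidPDE.IsClassicalNSSolutionOn (Set.Ico 0 T) ν 0 u p →
      Literature.Analysis.FluidPDE.IsLerayHopfOn T ν 0 (u 0) u →
      Literature.Analysis.FluidPDE.HasRapidSpatialDecay (u 0) → HalfPotentialEnstrophyBound T u) :
    Summit.NavierStokesRegularity.NavierStokesRegularity.Theses.PlaneEnergyCeiling.PlanarEnergyAPriori := by
  obtain ⟨C, hC, hD⟩ := hD
  intro ν T hν hT u p hcl hLH hdec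
  obtain ⟨M₀, hM₀, hinit⟩ := hI (u 0) hdec
  obtain ⟨W, hW0, hWb⟩ := hW ν T hν hT u p hcl hLH hdec
  refine ⟨2 * M₀ + C / ν * W ^ 2, fun t ht R c => ?_⟩
  have h1 := hD ν T hν hT u p hcl hLH hdec t ht R c
  have hsup : (⨆ t' ∈ Set.Icc 0 t, halfPotential u t') ≤ ENNReal.ofReal W := by
    refine iSup₂_le fun t' ht' => ?_
    exact hWb t' ⟨ht'.1, lt_of_le_of_lt ht'.2 ht.2⟩
  have hCν : 0 ≤ C / ν := div_nonneg hC.le hν.le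
  calc planarEnergy (u t) R c
      ≤ 2 * planarCeiling (u 0) + ENNReal.ofReal (C / ν) * (⨆ t' ∈ Set.Icc 0 t, halfPotential u t') ^ 2 := h1
    _ ≤ 2 * ENNReal.ofReal M₀ + ENNReal.ofReal (C / ν) * (ENNReal.ofReal W) ^ 2 := by
        gcongr
    _ = ENNReal.ofReal (2 * M₀ + C / ν * W ^ 2) := by
        rw [ENNReal.ofReal_add (by positivity) (by positivity), ENNReal.ofReal_mul (by norm_num),
          ENNReal.ofReal_ofNat, ENNReal.ofReal_mul hCν, ENNReal.ofReal_pow hW0]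

/-- **Why D6 gives no leverage — the half-potential diverges at every blow-up time** (provable from
Leray's enstrophy rate `‖∇u(t)‖₂² ≥ c ν^{3/2} (T*−t)^{-1/2}`, RRS2016 Lemma 6.11 / Thm 6.15, and
`∫₀ᵗ (t−s)^{-1/2}(T−s)^{-1/2} ds → ∞` as `t ↑ T`): if the solution does NOT extend smoothly past
`T`, then `sup_{t<T} I(u;t) = ∞`.  Hence "`HalfPotentialEnstrophyBound` along every frame solution
on `[0,T)`" is equivalent to "every frame solution extends past `T`" = NoBlowup (stmt-0054):
the 1-D law with the OPTIMAL magnitude flux lemma is exactly as strong as the summit's a-priori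
half, no stronger and no weaker. -/
def HalfPotentialDivergesAtBlowup : Prop :=
  ∀ (ν T : ℝ), 0 < ν → 0 < T → ∀ (u : ℝ → E3 → E3) (p : ℝ → E3 → ℝ),
    Literature.Analysis.FluidPDE.IsClassicalNSSolutionOn (Set.Ico 0 T) ν 0 u p →
    Literature.Analysis.FluidPDE.IsLerayHopfOn T ν 0 (u 0) u →
    Literature.Analysis.FluidPDE.HasRapidSpatialDecay (u 0) →
    ¬ Literature.Analysis.FluidPDE.HasSmoothExtensionPast ν 0 u T →
    ∀ W : ℝ, ∃ t ∈ Set.Ico 0 T, ENNReal.ofReal W < halfPotential u t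

/-- **Conditional corollary (calibration): Leray-rate ("Type-I") enstrophy ⇒ `P ≲ log²`.**
If `‖∇u(s)‖₂² ≤ C_Z (T−s)^{-1/2}` on `[0,T)` then the planar energies grow at most like
`A + B·log²(T/(T−t))` — against Agmon's `(T−t)^{-1/4}` from the same hypothesis, and against the
truth `log¹` for the scarred Type-I profile.  (From `DynamicPlanarCeiling`:
`I(u;t) ≤ C_Z ∫₀ᵗ (t−s)^{-1/2}(T−s)^{-1/2} ds ≤ C_Z (log(4T/(T−t)) + 2)`.) -/
def TypeIEnstrophyLogSqCeiling : Prop :=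
  ∀ (ν T : ℝ), 0 < ν → 0 < T → ∀ (u : ℝ → E3 → E3) (p : ℝ → E3 → ℝ),
    Literature.Analysis.FluidPDE.IsClassicalNSSolutionOn (Set.Ico 0 T) ν 0 u p →
    Literature.Analysis.FluidPDE.IsLerayHopfOn T ν 0 (u 0) u →
    Literature.Analysis.FluidPDE.HasRapidSpatialDecay (u 0) →
    (∃ CZ : ℝ, ∀ s ∈ Set.Ico 0 T, dissipation (u s) ≤ ENNReal.ofReal (CZ * (Real.sqrt (T - s))⁻¹)) →
    ∃ A B : ℝ, ∀ t ∈ Set.Ico 0 T, ∀ (R : E3 ≃ₗᵢ[ℝ] E3) (c : ℝ),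
      planarEnergy (u t) R c ≤ ENNReal.ofReal (A + B * (Real.log (T / (T - t))) ^ 2)

/-! ## S7 — zero net flux through planes (the kinematic fact that makes `F` pressure-gauge invariant) -/

/-- For a smooth rapidly decaying divergence-free field the net volume flux through every plane
vanishes, `∫_Π ⟪u, R e₂⟫ dA = 0`; consequently `bernoulliFlux u (p + π₀) = bernoulliFlux u p` for
every constant `π₀` (the free pressure constant of a frame solution is invisible to `F` itself,
not only to `osc F`).  Provable now (divergence theorem on a half-space under the decay). -/
def ZeroNetPlanarFlux : Prop :=
  ∀ (u : E3 → E3), ContDiff ℝ (⊤ : ℕ∞) u → Literature.Analysis.FluidPDE.HasRapidSpatialDecay u →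
    Literature.Analysis.FluidPDE.VectorCalculus.IsDivFree u →
    ∀ (R : E3 ≃ₗᵢ[ℝ] E3) (c : ℝ), (∫ y : E2, inner ℝ (u (planePt R y c)) (R (EuclideanSpace.single 2 1))) = 0

end Summit.NavierStokesRegularity.NavierStokesRegularity.Cruxes.PlanarEnergyAPriori.StrategistG1

end
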